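import Literature.AlgebraicGeometry.Frobenioids.PadicFrobenioidBaseTransport
import Literature.AlgebraicGeometry.Frobenioids.PadicFrobenioidIsFrobenioid
import Literature.AlgebraicGeometry.Frobenioids.ModelFrobenioidPreFrobenioid
import Mathlib.CategoryTheory.MorphismProperty.Basic
import HarnessLib

/-!
# Frobenioids II, Example 1.1 (ii): the hom-image of `C^⊢ ⊆ C` is cut out by "`Div ∈ Φ^⊢ = ℤ_{≥0} · log(p)`"

Mochizuki, *The geometry of Frobenioids II*, Kyushu J. Math. **62** (2008) 401–460, §1, Example 1.1 (ii), p. 8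
[cite: MochizukiFrdII2008, Ex 1.1 (ii) p.8]: for a monoprime subfunctor in monoids `Φ ⊆ Φ₀|_D` the `p`-adic Frobenioid
is the model Frobenioid of `(Φ, B := B₀|_D ×_{Φ₀^gp|_D} Φ^gp)`; "`Φ(K) ⊆ Λ · ord(ℚ_p^×)` … absolutely primitive".
Consumed by [IUTchI] Ex. 3.3 (i)/(iii) (d): "`Φ_{C_v^⊢} ⊆ Φ_{C_v}|_{D_v^⊢}` an absolutely primitive submonoid … these
monoids determine `p_v`-adic Frobenioids `C_v^⊢ ⊆ C_v` … which may be thought of as a subcategory of `C_v`".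

PROOF-ONLY file (abc-iut cell, seat abc-iut-L1-t4; GAP-LEDGER row G-w4d047g3-1), 0 definitions. It makes precise, for
the REAL objects of this directory, in what sense `C^⊢ ⊆ C` "is a subcategory": the functor is faithful
(`PadicFrobenioidInclusion.lean`, `PadicFrobenioidBaseTransport.lean`) and ITS IMAGE ON HOM-SETS IS CUT OUT BY THE
ZERO DIVISOR — a morphism `φ` of `C` between image objects comes from `C^⊢` iff `Div(φ) ∈ Φ^⊢`, i.e. iff `Div(φ)` is a
(nonnegative, integral) power of `log(p)`; and this morphism property is stable under composition with isomorphisms.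

* General model-Frobenioid bookkeeping ([FrdI] Thm. 5.2 (i), Prop. 5.3): `ModelFrobenioid.DataHom.exists_map_eq_of_preimages`
  — a morphism between image objects of the functor of a morphism of model data `(η, β)` lifts as soon as its `Div`
  and `u` have preimages under `η`, `β` and `η^gp` is injective at the source.
* For sub-data `T ≤ T'` of `Φ₀|_D` (`PadicFrobenioidSubfunctor.lean`, `PadicFrobenioidInclusion.lean`):
  `SubDatum.inclusionFunctor_map_div_mem` / `SubDatum.exists_inclusionFunctor_map_eq` — the image of
  `C_T → C_{T'}` on hom-sets is EXACTLY `{φ | Div(φ) ∈ Φ_T}`; `SubDatum.respectsIso_div_mem` — that property respects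
  isomorphisms of `C_{T'}` (isomorphisms of a model Frobenioid with divisorial `Φ` have `Div = 0`, `deg_Fr = 1`).
* [IUTchI] Ex. 3.3 (i) over ONE base (`GoodLocalKit.CdashToC`) and over the TWO bases `D_v^⊢ ⊆ D_v`
  (`GoodLocalKit.CdashToCOver … incl ε`, `incl` full, `ε` an isomorphism — e.g. the counit of `proj ⊣ incl` with `incl`
  fully faithful): `div_CdashToC(_Over)_map_mem`, `exists_CdashToC(_Over)_map_eq`, `respectsIso_div_mem_powers_logp(_over)`
  — exactly the inputs `hPΦ`, `hlift`, `[P.RespectsIso]` of abc-iut-w4-d047's non-full reconstructibility socket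
  `GoodLocalFrobenioid.cdashFromF_of_morphismProperty` (`Literature/IUT/HodgeTheaters/ReconstructibleAlongNonFull.lean`)
  for `P := fun X _ φ => (ModelFrobenioid.Hom.div φ).1 ∈ Submonoid.powers (primGen (proj ⋙ base) X.base)`.
No statement of the paper is strengthened; nothing here bears on [IUTchIII].
-/

namespace Literature.AlgebraicGeometry.Frobenioids

open CategoryTheory Opposite Function

/-! ### Lifting morphisms along the functor of a morphism of model data -/

namespace ModelFrobenioid

universe w v u

/-- The underlying map of an isomorphism of `CommMonCat` is injective. [cite: MochizukiFrdI2008, Def. 1.1(ii) p.19] -/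
theorem injective_hom_of_isIso_commMonCat {X Y : CommMonCat.{w}} (f : X ⟶ Y) [IsIso f] : Injective f.hom := by
  intro x y hxy
  have h' := congrArg (inv f).hom hxy
  change (f ≫ inv f).hom x = (f ≫ inv f).hom y at h'
  rwa [IsIso.hom_inv_id] at h'

variable {D : Type u} [Category.{v} D] {Φ B Φ' B' : Dᵒᵖ ⥤ CommMonCat.{w}} {DivB : B ⟶ monoidGp Φ}
  {DivB' : B' ⟶ monoidGp Φ'} (h : DataHom DivB DivB')

/-- **Lifting along the functor of a morphism of model data** `(η, β) : (Φ, B) → (Φ', B')` ([FrdI] Prop. 5.3): a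
morphism `φ : (A, η^gp α) → (A', η^gp α')` of `C'` between image objects whose `Div(φ)`, `u_φ` have preimages `Div`, `u`
under `η_A`, `β_A` is the image of the morphism `(deg_Fr(φ), Base(φ), Div, u)` of `C` — relation (d) of Thm. 5.2 (i) for it
being that of `φ` pulled back along the injective `η_A^gp`. [cite: MochizukiFrdI2008, Prop. 5.3 p.103] -/
theorem DataHom.exists_map_eq_of_preimages {X Y : ModelFrobenioid Φ B DivB}
    (φ : h.functor.obj X ⟶ h.functor.obj Y) (hinj : Injective (gpApp h.η (op X.base)))
    (Div : Φ.obj (op X.base)) (hDiv : (h.η.app (op X.base)).hom Div = Hom.div φ)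
    (u : B.obj (op X.base)) (hu : (h.β.app (op X.base)).hom u = Hom.unit φ) :
    ∃ g : X ⟶ Y, h.functor.map g = φ ∧ Hom.div g = Div ∧ Hom.unit g = u := by
  refine ⟨(⟨(Hom.degFr φ :), (Hom.base φ :), Div, u, ?_⟩ : Hom X Y), ?_, rfl, rfl⟩
  · apply hinj
    rw [map_mul, map_pow, gpApp_of, map_mul, gpApp_pullGp, h.comm, hDiv, hu]
    exact Hom.rel φ
  · apply hom_ext
    · rfl
    · rfl
    · exact hDiv
    · exact hu

end ModelFrobenioid

/-! ### Sub-data `T ≤ T'` of `Φ₀|_D`: the hom-image of `C_T → C_{T'}` is `{Div ∈ Φ_T}` -/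

namespace PadicFrd

section PrimGen

universe v u

variable {D : Type u} [Category.{v} D] {p : ℕ} (base : D ⥤ PadicFld.{u} p)

/-- The restriction maps of `Φ₀|_D` fix every power of `ord(p) ⊗ 1`. [cite: MochizukiFrdII2008, Ex 1.1 (ii) p.8] -/
theorem phi0Map_primGen_pow {A A' : Dᵒᵖ} (f : A ⟶ A') (n : ℕ) :
    phi0Map base f (primGen base A.unop ^ n) = primGen base A'.unop ^ n := by
  rw [map_pow, phi0Map_primGen]

end PrimGen

namespace SubDatum

universe v u

variable {D : Type u} [Category.{v} D] {p : ℕ} [Fact p.Prime] {base : D ⥤ PadicFld.{u} p}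
  (T T' : SubDatum base) (hTT' : ∀ A : D, T.S A ≤ T'.S A)
  (hloc : ∀ A : D, (base.obj A).IsPadicLocal) (hc : IsConnected D) (he : IsTotallyEpimorphic D)

/-- Morphisms of `C_{T'}` in the image of `C_T → C_{T'}` have zero divisor in `Φ_T` (the functor does not change
`Div`). [cite: MochizukiFrdII2008, Ex 1.1 (ii) p.8] -/
theorem inclusionFunctor_map_div_mem {X Y : (T.toDatum hloc hc he).frobenioid} (g : X ⟶ Y) :
    (ModelFrobenioid.Hom.div ((T.inclusionFunctor T' hTT' hloc hc he).map g)).1 ∈ T.S X.base :=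
  (ModelFrobenioid.Hom.div g).2

omit [Fact p.Prime] in
/-- `ι_{T'}^gp ∘ η^gp = ι_T^gp` for the inclusion `η : Φ_T ↪ Φ_{T'}` (`ι_{T'} ∘ η = ι_T`).
[cite: MochizukiFrdII2008, Ex 1.1 (ii) p.8] -/
theorem map_ι_gpApp_inclusionη (A : Dᵒᵖ) (γ : Algebra.GrothendieckGroup (T.Φ.obj A)) :
    MonGp.map (T'.ι.app A).hom (gpApp (T.inclusionη T' hTT') A γ) = MonGp.map (T.ι.app A).hom γ := by
  change MonGp.map (T'.ι.app A).hom (MonGp.map ((T.inclusionη T' hTT').app A).hom γ) = _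
  rw [← MonoidHom.comp_apply, ← MonGp.map_comp, ← CommMonCat.hom_comp, SubDatum.inclusionη_ι]

/-- The property "`Div(φ) ∈ Φ_T(A)`" of morphisms `φ : (A, α) → (A', α')` of `C_{T'}` respects isomorphisms: an
isomorphism of the model Frobenioid `C_{T'}` (`Φ_{T'}` monoprime, hence divisorial) has `Div = 0` and `deg_Fr = 1`, and
`Φ_T ⊆ Φ₀|_D` is a subfunctor. [cite: MochizukiFrdII2008, Ex 1.1 (ii) p.8] -/
theorem respectsIso_div_mem :
    MorphismProperty.RespectsIso
      (fun X _ φ => (ModelFrobenioid.Hom.div φ).1 ∈ T.S X.base :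
        MorphismProperty (T'.toDatum hloc hc he).frobenioid) := by
  have hΦd : Objectwise (fun M _ => IsDivisorial M) (T'.toDatum hloc hc he).Φ := fun A =>
    ((T'.toDatum hloc hc he).isMonoprime (op A)).isDivisorial
  refine MorphismProperty.RespectsIso.mk _ ?_ ?_
  · intro X Y Z e f hf
    change (ModelFrobenioid.div (e.hom ≫ f)).1 ∈ T.S X.base
    rw [ModelFrobenioid.div_comp, ModelFrobenioid.div_eq_one_of_isIso hΦd e.hom, one_pow, mul_one]
    exact T.map_mem (ModelFrobenioid.baseMap e.hom).op _ hf
  · intro X Y Z e f hf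
    change (ModelFrobenioid.div (f ≫ e.hom)).1 ∈ T.S X.base
    rw [ModelFrobenioid.div_comp, ModelFrobenioid.div_eq_one_of_isIso hΦd e.hom, map_one, one_mul,
      ModelFrobenioid.degFr_eq_one_of_isIso e.hom, PNat.one_coe, pow_one]
    exact hf

/-- **The hom-image of `C_T → C_{T'}` is cut out by `Div ∈ Φ_T`**: a morphism `φ : (A, α) → (A', α')` of `C_{T'}`
between image objects with `Div(φ) ∈ Φ_T(A)` IS the image of a morphism of `C_T` — its `u_φ = (x, γ) ∈
B_{T'}(A) = K_A^× ×_{Φ₀^gp} Φ_{T'}^gp` has `γ = -Φ(Base φ)(α') + deg_Fr(φ)·α + Div(φ) ∈ Φ_T^gp` by relation (d) of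
[FrdI] Thm. 5.2 (i), so `u_φ ∈ B_T(A)`. [cite: MochizukiFrdII2008, Ex 1.1 (ii) p.8] -/
theorem exists_inclusionFunctor_map_eq {X Y : (T.toDatum hloc hc he).frobenioid}
    (φ : (T.inclusionFunctor T' hTT' hloc hc he).obj X ⟶ (T.inclusionFunctor T' hTT' hloc hc he).obj Y)
    (hφ : (ModelFrobenioid.Hom.div φ).1 ∈ T.S X.base) :
    ∃ g : X ⟶ Y, (T.inclusionFunctor T' hTT' hloc hc he).map g = φ := by
  -- the morphism of model data `(η, β)` inducing the functor
  let h : ModelFrobenioid.DataHom (T.toDatum hloc hc he).divB (T'.toDatum hloc hc he).divB :=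
    T.inclusion T' hTT' hloc hc he
  -- the preimage of `Div(φ)` under `η`
  let Div : (T.toDatum hloc hc he).Φ.obj (op X.base) := ⟨(ModelFrobenioid.Hom.div φ).1, hφ⟩
  have hDiv : (h.η.app (op X.base)).hom Div = ModelFrobenioid.Hom.div φ := Subtype.ext rfl
  -- `u_φ = (x, γ) ∈ B_{T'}(A)`
  set w : T'.BSub (op X.base) := (ModelFrobenioid.Hom.unit φ :) with hw
  -- the `Φ_T^gp`-component `γ₀` of the preimage of `u_φ`, forced by relation (d)
  obtain ⟨γ₀, hγ₀⟩ : ∃ γ₀ : Algebra.GrothendieckGroup ((T.toDatum hloc hc he).Φ.obj (op X.base)),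
      γ₀ = (pullGp (T.toDatum hloc hc he).Φ (X := X.base) (Y := Y.base) (ModelFrobenioid.Hom.base φ :) Y.cls)⁻¹ *
        (X.cls ^ (ModelFrobenioid.Hom.degFr φ : ℕ) * Algebra.GrothendieckGroup.of Div) :=
    ⟨_, rfl⟩
  have hγ : gpApp h.η (op X.base) γ₀ = w.1.2 := by
    have hr := ModelFrobenioid.Hom.rel φ
    rw [hγ₀, map_mul, map_inv, map_mul, map_pow, gpApp_of, gpApp_pullGp, hDiv, inv_mul_eq_iff_eq_mul]
    exact hr
  -- the preimage of `u_φ` under `β`: `(x, γ₀) ∈ B_T(A)`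
  have hmem : (w.1.1, γ₀) ∈ T.BSub (op X.base) := by
    change ((divZeroOn base).app (op X.base)).hom w.1.1 = MonGp.map (T.ι.app (op X.base)).hom γ₀
    rw [← T.map_ι_gpApp_inclusionη T' hTT' (op X.base) γ₀]
    change _ = MonGp.map (T'.ι.app (op X.base)).hom (gpApp h.η (op X.base) γ₀)
    rw [hγ]
    exact w.2
  let u : (T.toDatum hloc hc he).B.obj (op X.base) := ⟨(w.1.1, γ₀), hmem⟩
  have hu : (h.β.app (op X.base)).hom u = ModelFrobenioid.Hom.unit φ := Subtype.ext (Prod.ext rfl hγ)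
  -- `η^gp` is injective (`Φ_{T'}(A) ⊆ Φ₀(A)` is cancellative)
  have hinj : Injective (gpApp h.η (op X.base)) := by
    haveI : IsCancelMul (Realification (OrdInt (base.obj X.base).K)) := isCancelMul_realification _
    haveI : IsCancelMul ((T'.toDatum hloc hc he).Φ.obj (op X.base)) :=
      show IsCancelMul (T'.S X.base) from inferInstance
    refine MonGp.map_injective _ fun a b hab => Subtype.ext ?_
    have hab' := congrArg Subtype.val hab
    exact hab'
  obtain ⟨g, hg, -, -⟩ := h.exists_map_eq_of_preimages φ hinj Div hDiv u hu
  exact ⟨g, hg⟩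

end SubDatum

/-! ### [IUTchI] Ex. 3.3 (i) over one base: `C^⊢ ⊆ C` (`GoodLocalKit.CdashToC`) -/

namespace GoodLocalKit

universe v v' u

variable {D : Type u} [Category.{v} D] {p : ℕ} [Fact p.Prime] (base : D ⥤ PadicFld.{u} p)
  (hloc : ∀ A : D, (base.obj A).IsPadicLocal) (hc : IsConnected D) (he : IsTotallyEpimorphic D)

/-- Every morphism in the image of `C_v^⊢ ⊆ C_v` has zero divisor in `Φ_{C_v^⊢} = ℤ_{≥0} · log(p_v)`.
[cite: MochizukiFrdII2008, Ex 1.1 (ii) p.8] -/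
theorem div_CdashToC_map_mem {t₁ t₂ : Cdash base hloc hc he} (g : t₁ ⟶ t₂) :
    (ModelFrobenioid.Hom.div ((CdashToC base hloc hc he).map g)).1 ∈
      Submonoid.powers (primGen base ((CdashToC base hloc hc he).obj t₁).base) :=
  SubDatum.inclusionFunctor_map_div_mem (primSubDatum base hloc) (perfSubDatum base hloc)
    (primSubDatum_le_perfSubDatum base hloc) hloc hc he g

/-- **The hom-image of `C_v^⊢ ⊆ C_v` is cut out by `Div ∈ ℤ_{≥0} · log(p_v)`**: a morphism of `C_v` between objects
of `C_v^⊢` whose zero divisor is a power of `log(p_v)` comes from `C_v^⊢`. [cite: MochizukiFrdII2008, Ex 1.1 (ii) p.8] -/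
theorem exists_CdashToC_map_eq {t₁ t₂ : Cdash base hloc hc he}
    (φ : (CdashToC base hloc hc he).obj t₁ ⟶ (CdashToC base hloc hc he).obj t₂)
    (hφ : (ModelFrobenioid.Hom.div φ).1 ∈ Submonoid.powers (primGen base ((CdashToC base hloc hc he).obj t₁).base)) :
    ∃ g : t₁ ⟶ t₂, (CdashToC base hloc hc he).map g = φ :=
  SubDatum.exists_inclusionFunctor_map_eq (primSubDatum base hloc) (perfSubDatum base hloc)
    (primSubDatum_le_perfSubDatum base hloc) hloc hc he φ hφ

/-- The property "`Div(φ)` is a power of `log(p_v)`" of morphisms of `C_v` respects isomorphisms.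
[cite: MochizukiFrdII2008, Ex 1.1 (ii) p.8] -/
theorem respectsIso_div_mem_powers_logp :
    MorphismProperty.RespectsIso
      (fun X _ φ => (ModelFrobenioid.Hom.div φ).1 ∈ Submonoid.powers (primGen base X.base) :
        MorphismProperty (Cv base hloc hc he)) :=
  SubDatum.respectsIso_div_mem (primSubDatum base hloc) (perfSubDatum base hloc) hloc hc he

/-! ### [IUTchI] Ex. 3.3 (i) over the two bases `D_v^⊢ ⊆ D_v`: `C_v^⊢ → C_v` (`GoodLocalKit.CdashToCOver`) -/

variable {Dv : Type u} [Category.{v'} Dv] (proj : Dv ⥤ D)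
  (hlocv : ∀ A : Dv, ((proj ⋙ base).obj A).IsPadicLocal) (hcv : IsConnected Dv) (hev : IsTotallyEpimorphic Dv)
  (incl : D ⥤ Dv) (ε : incl ⋙ proj ⟶ 𝟭 D)

/-- The property "`Div(φ)` is a power of `log(p_v)`" of morphisms of `C_v` (over `D_v`) respects isomorphisms.
[cite: MochizukiFrdII2008, Ex 1.1 (ii) p.8] -/
theorem respectsIso_div_mem_powers_logp_over :
    MorphismProperty.RespectsIso
      (fun X _ φ => (ModelFrobenioid.Hom.div φ).1 ∈ Submonoid.powers (primGen (proj ⋙ base) X.base) :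
        MorphismProperty (CvOver base proj hlocv hcv hev)) :=
  SubDatum.respectsIso_div_mem (primSubDatum (proj ⋙ base) hlocv) (perfSubDatum (proj ⋙ base) hlocv) hlocv hcv hev

/-- Every morphism in the image of `C_v^⊢ → C_v` (two bases) has zero divisor a power of `log(p_v)` (the transport
along `ε` fixes `log(p_v)`: field homomorphisms fix `p_v`). [cite: MochizukiFrdII2008, Ex 1.1 (ii) p.8] -/
theorem div_CdashToCOver_map_mem {t₁ t₂ : Cdash base hloc hc he} (g : t₁ ⟶ t₂) :
    (ModelFrobenioid.Hom.div ((CdashToCOver base hloc hc he proj hlocv hcv hev incl ε).map g)).1 ∈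
      Submonoid.powers (primGen (proj ⋙ base) ((CdashToCOver base hloc hc he proj hlocv hcv hev incl ε).obj t₁).base) := by
  obtain ⟨n, hn⟩ := (Submonoid.mem_powers_iff _ _).mp (ModelFrobenioid.Hom.div g).2
  refine (Submonoid.mem_powers_iff _ _).mpr ⟨n, ?_⟩
  exact ((phi0Map_primGen_pow base (ε.app t₁.base).op n).symm.trans
    (congrArg (phi0Map base (ε.app t₁.base).op) hn) :)

/-- **The hom-image of `C_v^⊢ → C_v` (two bases, `incl : D_v^⊢ → D_v` full, `ε : incl ⋙ proj ≅ 𝟭`) is cut out by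
`Div ∈ ℤ_{≥0} · log(p_v)`**: a morphism `φ` of `C_v` between image objects whose zero divisor is a power of `log(p_v)`
comes from `C_v^⊢` — lift `Base(φ)` through the full `incl`, transport `(Div(φ), u_φ)` back along the isomorphism `ε`
(relation (d) of [FrdI] Thm. 5.2 (i) is pulled back along the injective `Φ(ε)^gp`, using the naturality of `ε`), and
apply the one-base statement (`u_φ ∈ B^⊢ = 𝒪^× · p^ℤ` is forced by relation (d), the classes of image objects lying in
`ℤ · log(p_v)`). This is the input `hlift` (with `div_CdashToCOver_map_mem` = `hPΦ`,
`respectsIso_div_mem_powers_logp_over` = `RespectsIso`) of the non-full reconstructibility socket for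
[IUTchI] Ex. 3.3 (iii) (d). [cite: MochizukiFrdII2008, Ex 1.1 (ii) p.8] -/
theorem exists_CdashToCOver_map_eq [incl.Full] [IsIso ε] {t₁ t₂ : Cdash base hloc hc he}
    (φ : (CdashToCOver base hloc hc he proj hlocv hcv hev incl ε).obj t₁ ⟶
      (CdashToCOver base hloc hc he proj hlocv hcv hev incl ε).obj t₂)
    (hφ : (ModelFrobenioid.Hom.div φ).1 ∈
      Submonoid.powers (primGen (proj ⋙ base) ((CdashToCOver base hloc hc he proj hlocv hcv hev incl ε).obj t₁).base)) :
    ∃ g : t₁ ⟶ t₂, (CdashToCOver base hloc hc he proj hlocv hcv hev incl ε).map g = φ := by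
  obtain ⟨n, hn⟩ := (Submonoid.mem_powers_iff _ _).mp hφ
  -- notation: `C_v` over `D_v^⊢`, the images `X`, `Y` of `t₁`, `t₂` in it, the components of `ε` (retyped)
  let d := Datum.perf base hloc hc he
  let X : Cv base hloc hc he := (CdashToC base hloc hc he).obj t₁
  let Y : Cv base hloc hc he := (CdashToC base hloc hc he).obj t₂
  let cX : Algebra.GrothendieckGroup (d.Φ.obj (op t₁.base)) := X.cls
  let cY : Algebra.GrothendieckGroup (d.Φ.obj (op t₂.base)) := Y.cls
  haveI hΦiso : IsIso (d.Φ.map (ε.app t₁.base).op) := inferInstance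
  haveI hBiso : IsIso (d.B.map (ε.app t₁.base).op) := inferInstance
  haveI h0iso : IsIso ((phiZeroOn base).map (ε.app t₁.base).op) := inferInstance
  let e₁ : proj.obj (incl.obj t₁.base) ⟶ t₁.base := ε.app t₁.base
  let e₂ : proj.obj (incl.obj t₂.base) ⟶ t₂.base := ε.app t₂.base
  haveI hΦiso' : IsIso (d.Φ.map e₁.op) := hΦiso
  haveI hBiso' : IsIso (d.B.map e₁.op) := hBiso
  -- the components of `φ`, read over `D_v^⊢`
  let bφ : incl.obj t₁.base ⟶ incl.obj t₂.base := (ModelFrobenioid.Hom.base φ :)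
  let Dφ : d.Φ.obj (op (proj.obj (incl.obj t₁.base))) := (ModelFrobenioid.Hom.div φ :)
  let uφ : d.B.obj (op (proj.obj (incl.obj t₁.base))) := (ModelFrobenioid.Hom.unit φ :)
  have hrelφ : pullGp d.Φ e₁ cX ^ (ModelFrobenioid.Hom.degFr φ : ℕ) * Algebra.GrothendieckGroup.of Dφ =
      pullGp d.Φ (proj.map bφ) (pullGp d.Φ e₂ cY) * divB d.Φ d.B d.divB (op (proj.obj (incl.obj t₁.base))) uφ :=
    ModelFrobenioid.Hom.rel φ
  -- the lift: `Base` through the full `incl`, `(Div, u)` back along the isomorphism `ε`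
  let f : t₁.base ⟶ t₂.base := incl.preimage bφ
  have hf : incl.map f = bφ := incl.map_preimage bφ
  have hnat : e₁ ≫ f = proj.map bφ ≫ e₂ := by
    have h2 : proj.map (incl.map f) ≫ e₂ = e₁ ≫ f := ε.naturality f
    rw [hf] at h2
    exact h2.symm
  let Div : d.Φ.obj (op t₁.base) := (inv (d.Φ.map e₁.op)).hom Dφ
  let u : d.B.obj (op t₁.base) := (inv (d.B.map e₁.op)).hom uφ
  have hDiv : (d.Φ.map e₁.op).hom Div = Dφ := by
    change (inv (d.Φ.map e₁.op) ≫ d.Φ.map e₁.op).hom Dφ = _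
    rw [IsIso.inv_hom_id]
    rfl
  have hu : (d.B.map e₁.op).hom u = uφ := by
    change (inv (d.B.map e₁.op) ≫ d.B.map e₁.op).hom uφ = _
    rw [IsIso.inv_hom_id]
    rfl
  -- relation (d) for the lift, pulled back along the injective `Φ(ε)^gp`
  have hinj : Injective (pullGp d.Φ e₁) :=
    ModelFrobenioid.injective_hom_of_isIso_commMonCat (MonGp.functor.map (d.Φ.map e₁.op))
  have hrel : cX ^ (ModelFrobenioid.Hom.degFr φ : ℕ) * Algebra.GrothendieckGroup.of Div =
      pullGp d.Φ f cY * divB d.Φ d.B d.divB (op t₁.base) u := by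
    apply hinj
    rw [map_mul, map_pow, pullGp_of, map_mul, ← pullGp_comp, pullGp_divB, hnat, pullGp_comp, hDiv, hu]
    exact hrelφ
  let ψ : X ⟶ Y := ⟨(ModelFrobenioid.Hom.degFr φ :), f, Div, u, hrel⟩
  -- `Div(ψ)` is a power of `log(p_v)`: `Φ₀(ε)` is injective and fixes `log(p_v)`
  have hmem : (ModelFrobenioid.Hom.div ψ).1 ∈ Submonoid.powers (primGen base ((CdashToC base hloc hc he).obj t₁).base) := by
    have hinj0 : Injective (phi0Map base e₁.op) :=
      ModelFrobenioid.injective_hom_of_isIso_commMonCat ((phiZeroOn base).map (ε.app t₁.base).op)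
    refine (Submonoid.mem_powers_iff _ _).mpr ⟨n, hinj0 ?_⟩
    exact ((phi0Map_primGen_pow base e₁.op n).trans (hn.trans (congrArg Subtype.val hDiv).symm) :)
  obtain ⟨g, hg⟩ := exists_CdashToC_map_eq base hloc hc he ψ hmem
  refine ⟨g, ?_⟩
  -- `CdashToCOver g = transport (CdashToC g) = transport ψ = φ`, componentwise
  unfold CdashToCOver
  rw [Functor.comp_map, Functor.comp_map, Functor.comp_map, hg]
  apply ModelFrobenioid.hom_ext
  · rfl
  · exact hf
  · exact hDiv
  · exact hu

end GoodLocalKit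

end PadicFrd

end Literature.AlgebraicGeometry.Frobenioids
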